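import Summits.BirchSwinnertonDyer.BirchSwinnertonDyer.Theorems.AlignedTransportAtTwoMainConjectureOfRankZeroBSDAtTwoSharedCubicDivisionField
import Summits.BirchSwinnertonDyer.BirchSwinnertonDyer.Theorems.AlignedTransportAtTwoMainConjectureOfRankZeroBSDAtTwoSexticCriterion
import HarnessLib

/-!
# Route `AlignedTransportAtTwo`, crux C2 `MainConjectureOfRankZeroBSDAtTwo` (stmt-BirchSwinnertonDyer-22298):
# THE CUBIC-FIELD DOOR — C2's Iwasawa input in the currency of an ABSTRACT cubic number field `F ∋ e`, `c_W(e) = 0`: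
# `μ₂(ℚ(W[2])^cyc) = 0 ⟺ μ₂(F^cyc) = 0` (both signs), and on the `Δ < 0` cell `μ₂(F^cyc) = 0` + PRINT + MuIneqʳ ⟹ MC₂(W);
# hence «Iwasawa's `μ₂ = 0` for all cubic number fields» + PRINT + MuIneqʳ ⟹ the crux restricted to `Δ < 0`

HONEST FRAMING. WIDTH-5 attached prover seat `bsd-line-att-p4` g31 on line `birth` of the lead `bsd-line-att-p2`; `--supports`
stmt-BirchSwinnertonDyer-22298, closes nothing; BSD is NOT proved; crux C2, its verdict «blocked-on `Rank1Residual.GreenbergMuConjectureIrreducible`»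
and every registered stub untouched. THEOREMS ONLY (no `def`, no named fact, no `sorry`). CONDITIONAL on the displayed named facts (PRINT: Kato 17.4
(1)(2) at `2`, Greenberg 4.1, period unit, modularity, GZK, Lim 2017 Thm. 3.5 at `2`) and on the registered stub MuIneqʳ (`hI`, verbatim).

WHAT. The lead's sextic criterion (p608587) and att-p3 g34's single-cubic iff state C2's open input on `Δ < 0` as `μ₂ = 0` for the MODELS
`ℚ(W[2]) ⊆ ℚ̄`, `ℚ⟮x(T_j)⟯ ⊆ ℚ̄`. With this seat's `ℚ⟮x(T_j)⟯ ≃ₐ[ℚ] F` (`…SharedCubicDivisionField`) the input is read on ANY abstract cubic number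
field `F` containing a root `e` of the `u`-cubic `c_W` — the currency of crux C1 and of a classical Iwasawa-theory statement:
* `forall_classicalMuVanishes_divisionField_two_iff_cubicField` — `W` without rational `2`-torsion abscissa, `Δ_W ∉ ℚ²`, `2Δ_W ∉ ℚ²` (BOTH signs):
  **`(∀ cyclotomic κ_T of ℚ(W[2]), μ = 0) ⟺ (∀ cyclotomic κ_F of F, μ = 0)`**; `…_of_isOrdinaryAt` on the binders.
* ★★ `mazurMainConjecture_two_of_classicalMu_cubicField_of_Δ_neg` — THE CUBIC-FIELD DOOR: `W` in the `Δ < 0` part of the cell (good ordinary at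
  `2`, no rational `2`-torsion, `Δ_W < 0`, `r_an = 0`, analytic `μ₂ = 0`, `BSD₂(W)`), `F ∋ e` with `c_W(e) = 0`, `[F:ℚ] = 3`, and `μ₂ = 0` for the
  cyclotomic `ℤ₂`-towers of `F` + PRINT + MuIneqʳ ⟹ **`MC₂(W)`**.
* ★★ `crux_negDisc_of_forall_cubicField_classicalMu` — **«`μ₂ = 0` for every cubic number field» + PRINT + MuIneqʳ ⟹ C2 restricted to
  `Δ < 0`** (every cell curve with `Δ_W < 0` and `BSD₂(W)` satisfies MC₂): the `Δ < 0` three quarters of the crux follow from the classical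
  Iwasawa `μ`-conjecture at `2` for (complex) cubic fields, stated with NO reference to `W`, `ℚ̄`-models or torsion points.

References: [Greenberg2001IwasawaPastPresent] (Iwasawa's `μ = 0` conjecture); [Iwasawa1973MuInvariants] §3; [Lim2017FineSelmer] §3 Thm. 3.5;
[Kato2004Asterisque] Thm. 17.4, §17.13; tree: lead `…SexticCriterion`, att-p3 g34 `…ResolventMuUnconditional`, att-p4 g29 `…SignFreeOneRoot`,
g31 `…SharedCubicDivisionField`.
-/

-- the Theorems namespace of this sub repeats the summit name by design (D-0017 nested layout)
set_option linter.dupNamespace false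
set_option autoImplicit false

noncomputable section

open scoped Classical NumberField

namespace Summit.BirchSwinnertonDyer.BirchSwinnertonDyer.Theorems.AlignedTransportAtTwoSharedCubicFieldDoor

open NumberField Polynomial WeierstrassCurve IntermediateField Field CongruenceSubgroup
  Literature.NumberTheory.EllipticCurves Literature.NumberTheory.EllipticCurves.Greenberg1999
  Literature.NumberTheory.EllipticCurves.ModularForms Literature.NumberTheory.EllipticCurves.Rank1Residual
  Literature.NumberTheory.EllipticCurves.Module
  Literature.NumberTheory.EllipticCurves.DokchitserDokchitser2012
  Literature.NumberTheory.EllipticCurves.ZpExtension Literature.NumberTheory.GaloisRepresentations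
  Literature.NumberTheory.IwasawaTheory Literature.NumberTheory.NumberFields
  Summit.BirchSwinnertonDyer.Rank1Residual Summit.BirchSwinnertonDyer.Rank1Residual.X1.MuLambda
  Summit.BirchSwinnertonDyer.Rank1Residual.X5 Summit.BirchSwinnertonDyer.Rank1Residual.F1Sign2
  Summit.BirchSwinnertonDyer.BirchSwinnertonDyer.Theorems.Rank1ResidualX1Defs
  Summit.BirchSwinnertonDyer.BirchSwinnertonDyer.Theorems.AlignedTransportAtTwoSexticCriterion
  Summit.BirchSwinnertonDyer.BirchSwinnertonDyer.Theorems.AlignedTransportAtTwoSexticNormRelationDescentSignFree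
  Summit.BirchSwinnertonDyer.BirchSwinnertonDyer.Theorems.AlignedTransportAtTwoResolventMuUnconditional
  Summit.BirchSwinnertonDyer.BirchSwinnertonDyer.Theorems.AlignedTransportAtTwoSharedCubicDivisionField

/-! ## §1 The sextic input read on an abstract cubic field (both signs) -/

section Currency

variable (W : WeierstrassCurve ℚ) [W.IsElliptic]

/-- **`μ₂(ℚ(W[2])^cyc) = 0 ⟺ μ₂(F^cyc) = 0`** for `W` without rational `2`-torsion abscissa, `Δ_W ∉ ℚ²`, `2Δ_W ∉ ℚ²` (BOTH signs of `Δ_W`) and ANY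
cubic number field `F` containing a root `e` of the `u`-cubic `c_W` (all cyclotomic `ℤ₂`-towers, growth form): att-p3 g34's single-cubic iff on the
model `ℚ⟮x(T_0)⟯` composed with `ℚ⟮x(T_0)⟯ ≃ₐ[ℚ] F`. [cite: Iwasawa1973MuInvariants, §3] [cite: Washington1997, §13.1] -/
theorem forall_classicalMuVanishes_divisionField_two_iff_cubicField (ht : ∀ x : ℚ, ¬ HasRationalTwoTorsionX W x)
    (hsq : ¬ IsSquare W.Δ) (h2Δ : ¬ IsSquare (2 * W.Δ))
    {F : Type} [Field F] [NumberField F] (hF : Module.finrank ℚ F = 3) {e : F} (he : aeval e (twoDivisionUCubic W) = 0) :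
    (∀ κT : ZpExtension ↥(W.divisionField 2) 2, κT.IsCyclotomic → ClassicalMuVanishes κT) ↔
      ∀ κF : ZpExtension F 2, κF.IsCyclotomic → ClassicalMuVanishes κF := by
  rw [classicalMuVanishes_divisionField_two_iff_single_cubic_of_not_isSquare W ht hsq h2Δ 0,
    forall_classicalMuVanishes_iff_adjoin_xT_of_root W ht hF he 0]

/-- The same on the cruxes' binders (`W` globally minimal, good ordinary at `2`: `2Δ_W ∉ ℚ²` is automatic). [cite: Iwasawa1973MuInvariants, §3] -/
theorem forall_classicalMuVanishes_divisionField_two_iff_cubicField_of_isOrdinaryAt [W.IsGloballyMinimal] (hord : IsOrdinaryAt W 2)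
    (ht : ∀ x : ℚ, ¬ HasRationalTwoTorsionX W x) (hsq : ¬ IsSquare W.Δ)
    {F : Type} [Field F] [NumberField F] (hF : Module.finrank ℚ F = 3) {e : F} (he : aeval e (twoDivisionUCubic W) = 0) :
    (∀ κT : ZpExtension ↥(W.divisionField 2) 2, κT.IsCyclotomic → ClassicalMuVanishes κT) ↔
      ∀ κF : ZpExtension F 2, κF.IsCyclotomic → ClassicalMuVanishes κF :=
  forall_classicalMuVanishes_divisionField_two_iff_cubicField W ht hsq (not_isSquare_two_mul_Δ_of_isOrdinaryAt W hord) hF he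

end Currency

/-! ## §2 The cubic-field door on the `Δ < 0` cell -/

section Door

variable (W : WeierstrassCurve ℚ) [W.IsElliptic] [W.IsGloballyMinimal]

/-- ★★ **THE CUBIC-FIELD DOOR.** PRINT {Kato 17.4 (1)(2) at `2` for `W` (`h17`), Greenberg 4.1 (`hGr`), period unit (`hper`), modularity
(`hmod`), GZK (`hGZK`), Lim 2017 Thm. 3.5 at `2` (`hLim`)} + MuIneqʳ (`hI`, registered stub verbatim) + `W` in the `Δ < 0` part of the cell (good
ordinary at `2`, no rational `2`-torsion abscissa, `Δ_W < 0`, `r_an = 0`, analytic `μ₂ = 0`, `BSD₂(W)`) + a cubic number field `F ∋ e` with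
`c_W(e) = 0` whose cyclotomic `ℤ₂`-towers have `μ = 0` ⟹ **Mazur's `2`-adic main conjecture for `W`**. [cite: Lim2017FineSelmer, §3 Thm. 3.5]
[cite: Kato2004Asterisque, Thm. 17.4 (p. 273) and §17.13 (pp. 279–280)] [cite: GreenbergLNM1716, Thm. 4.1 (p. 102)] -/
theorem mazurMainConjecture_two_of_classicalMu_cubicField_of_Δ_neg
    (h17 : ∀ [NeZero (W.conductorNorm ℤ)] (f : CuspForm (Gamma0 (W.conductorNorm ℤ)) 2),
      kato_divisibility_allPrimes W 2 (f := f))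
    (hGr : Greenberg1999.thm41_charValue_rankZero_anyPrime)
    (hper : realPeriodRat_eq_unit_mul_plusPeriod_two) (hmod : nonempty_modularParametrizationData)
    (hGZK : rank_eq_analyticRank_of_analyticRank_le_one)
    (hLim : Lim2017.thm35_at_two_fineSelmerDual_moduleFinite_of_classicalMuVanishes_of_le_divisionField_four)
    (hI : ∀ (W : WeierstrassCurve ℚ) [W.IsElliptic] [W.IsGloballyMinimal], IsOrdinaryAt W 2 →
      (∀ x : ℚ, ¬ HasRationalTwoTorsionX W x) →
      ∀ (κ : ZpExtension ℚ 2) (γ : Field.absoluteGaloisGroup ℚ), κ.IsCyclotomic →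
      κ.IsTopGenerator γ → IsCyclotomicVariable 2 γ →
      ∀ ⦃N : ℕ⦄ [NeZero N] (f : CuspForm (Gamma0 N) 2), IsNewformOf W f →
      ∀ Gp : IwasawaAlgebra 2, iwasawaToPowerSeries 2 Gp = padicLFunction f (unitRoot W 2 : ℚ_[2]) →
      ∀ (D : W.SelmerDualData κ γ) (Yr : W.FineSelmerDualDataRelaxedInf κ γ),
        lengthAt (IwasawaAlgebra 2) D.X ⟨IwasawaAlgebra.augIdealP 2, IwasawaAlgebra.isPrime_augIdealP_holds 2⟩ ≤
          lengthAt (IwasawaAlgebra 2) (IwasawaAlgebra 2 ⧸ Ideal.span {Gp})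
              ⟨IwasawaAlgebra.augIdealP 2, IwasawaAlgebra.isPrime_augIdealP_holds 2⟩ +
            lengthAt (IwasawaAlgebra 2) Yr.X ⟨IwasawaAlgebra.augIdealP 2, IwasawaAlgebra.isPrime_augIdealP_holds 2⟩)
    (hord : IsOrdinaryAt W 2) (ht : ∀ x : ℚ, ¬ HasRationalTwoTorsionX W x) (hΔ : W.Δ < 0) (hr : W.analyticRank = 0)
    (hμan : ∀ ⦃N : ℕ⦄ [NeZero N] (f : CuspForm (Gamma0 N) 2), IsNewformOf W f →
      ∀ G : IwasawaAlgebra 2, IsEvenBranchLiftAtTwo W f G → red G ≠ 0)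
    (hbsd : BSDp W 2)
    {F : Type} [Field F] [NumberField F] (hF : Module.finrank ℚ F = 3) {e : F} (he : aeval e (twoDivisionUCubic W) = 0)
    (hμF : ∀ κF : ZpExtension F 2, κF.IsCyclotomic → ClassicalMuVanishes κF) :
    MazurMainConjecture W 2 :=
  have hsq : ¬ IsSquare W.Δ := fun ⟨r, hr'⟩ ↦ by nlinarith [mul_self_nonneg r]
  mazurMainConjecture_two_of_classicalMu_divisionField_two_of_Δ_neg W h17 hGr hper hmod hGZK hLim hI hord ht hΔ hr hμan hbsd
    ((forall_classicalMuVanishes_divisionField_two_iff_cubicField_of_isOrdinaryAt W hord ht hsq hF he).mpr hμF)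

end Door

/-! ## §3 «`μ₂ = 0` for all cubic number fields» gives the `Δ < 0` three quarters of the crux -/

/-- ★★ **Iwasawa's `μ₂ = 0` for cubic number fields + PRINT + MuIneqʳ ⟹ C2 restricted to `Δ < 0`.** Granted PRINT {Kato 17.4 (1)(2) at `2`
(every curve), Greenberg 4.1, period unit, modularity, GZK, Lim 2017 Thm. 3.5 at `2`} and MuIneqʳ: if every number field `F` of degree `3`
has `μ = 0` (growth form) along every cyclotomic `ℤ₂`-extension, then **every curve `W` of the seed cell with `Δ_W < 0` and `BSD₂(W)` satisfies
Mazur's `2`-adic main conjecture**. For each `W` the cubic field used is the model `ℚ⟮x(T_0)⟯ ⊆ ℚ̄` of its `2`-torsion point field.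
(Only complex cubic fields occur; the hypothesis is Iwasawa's `μ`-conjecture at `2` for cubic fields — OPEN; Ferrero–Washington covers the cyclic ones,
which do not occur here.) Conditional; BSD is not proved by any of this. [cite: Greenberg2001IwasawaPastPresent, §2 (Iwasawa's μ = 0 conjecture)]
[cite: Lim2017FineSelmer, §3 Thm. 3.5] [cite: Kato2004Asterisque, Thm. 17.4 (p. 273) and §17.13 (pp. 279–280)] -/
theorem crux_negDisc_of_forall_cubicField_classicalMu
    (h17 : ∀ (V : WeierstrassCurve ℚ) [V.IsElliptic] [V.IsGloballyMinimal] [NeZero (V.conductorNorm ℤ)]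
      (f : CuspForm (Gamma0 (V.conductorNorm ℤ)) 2), kato_divisibility_allPrimes V 2 (f := f))
    (hGr : Greenberg1999.thm41_charValue_rankZero_anyPrime)
    (hper : realPeriodRat_eq_unit_mul_plusPeriod_two) (hmod : nonempty_modularParametrizationData)
    (hGZK : rank_eq_analyticRank_of_analyticRank_le_one)
    (hLim : Lim2017.thm35_at_two_fineSelmerDual_moduleFinite_of_classicalMuVanishes_of_le_divisionField_four)
    (hI : ∀ (W : WeierstrassCurve ℚ) [W.IsElliptic] [W.IsGloballyMinimal], IsOrdinaryAt W 2 →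
      (∀ x : ℚ, ¬ HasRationalTwoTorsionX W x) →
      ∀ (κ : ZpExtension ℚ 2) (γ : Field.absoluteGaloisGroup ℚ), κ.IsCyclotomic →
      κ.IsTopGenerator γ → IsCyclotomicVariable 2 γ →
      ∀ ⦃N : ℕ⦄ [NeZero N] (f : CuspForm (Gamma0 N) 2), IsNewformOf W f →
      ∀ Gp : IwasawaAlgebra 2, iwasawaToPowerSeries 2 Gp = padicLFunction f (unitRoot W 2 : ℚ_[2]) →
      ∀ (D : W.SelmerDualData κ γ) (Yr : W.FineSelmerDualDataRelaxedInf κ γ),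
        lengthAt (IwasawaAlgebra 2) D.X ⟨IwasawaAlgebra.augIdealP 2, IwasawaAlgebra.isPrime_augIdealP_holds 2⟩ ≤
          lengthAt (IwasawaAlgebra 2) (IwasawaAlgebra 2 ⧸ Ideal.span {Gp})
              ⟨IwasawaAlgebra.augIdealP 2, IwasawaAlgebra.isPrime_augIdealP_holds 2⟩ +
            lengthAt (IwasawaAlgebra 2) Yr.X ⟨IwasawaAlgebra.augIdealP 2, IwasawaAlgebra.isPrime_augIdealP_holds 2⟩)
    (hcubic : ∀ (F : Type) [Field F] [NumberField F], Module.finrank ℚ F = 3 →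
      ∀ κF : ZpExtension F 2, κF.IsCyclotomic → ClassicalMuVanishes κF) :
    ∀ (W : WeierstrassCurve ℚ) [W.IsElliptic] [W.IsGloballyMinimal], ¬ W.HasCM →
      IsOrdinaryAt W 2 → (∀ x : ℚ, ¬ HasRationalTwoTorsionX W x) → ¬ IsSquare W.Δ → W.Δ < 0 →
      W.analyticRank = 0 →
      (∀ ⦃N : ℕ⦄ [NeZero N] (f : CuspForm (Gamma0 N) 2), IsNewformOf W f →
        ∀ G : IwasawaAlgebra 2, IsEvenBranchLiftAtTwo W f G → red G ≠ 0) →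
      BSDp W 2 → MazurMainConjecture W 2 := by
  intro W _ _ _ hord ht hsq hΔ hr hμan hbsd
  haveI : FiniteDimensional ℚ ↥ℚ⟮xT W two_ne_zero 0⟯ := adjoin.finiteDimensional ((AlgebraicClosure.isAlgebraic ℚ).isAlgebraic _).isIntegral
  haveI : NumberField ↥ℚ⟮xT W two_ne_zero 0⟯ := NumberField.mk
  -- the model `ℚ⟮x(T_0)⟯ ⊆ ℚ̄` of the cubic point field is a cubic number field
  have hβ : aeval (xT W two_ne_zero 0) W.twoTorsionPolynomial.toPoly = 0 :=
    (mem_rootSet_of_ne (AlignedTransportAtTwoFineRoad.DivisionCubic.twoTorsionPolynomial_toPoly_ne_zero W two_ne_zero)).mp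
      (AlignedTransportAtTwoFineRoad.DivisionCubic.xT_mem_rootSet W two_ne_zero 0)
  have h3 : Module.finrank ℚ ↥ℚ⟮xT W two_ne_zero 0⟯ = 3 :=
    AddKatoTwo.finrank_adjoin_root_twoTorsionPolynomial_eq_three W
      (AlignedTransportAtTwoSeed.irr_two_of_forall_not_hasRationalTwoTorsionX W ht) hβ
  have hT : ∀ κT : ZpExtension ↥(W.divisionField 2) 2, κT.IsCyclotomic → ClassicalMuVanishes κT :=
    (classicalMuVanishes_divisionField_two_iff_single_cubic_of_not_isSquare W ht hsq
      (not_isSquare_two_mul_Δ_of_isOrdinaryAt W hord) 0).mpr (hcubic _ h3)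
  exact mazurMainConjecture_two_of_classicalMu_divisionField_two_of_Δ_neg W (h17 W) hGr hper hmod hGZK hLim hI hord ht hΔ hr hμan hbsd hT

end Summit.BirchSwinnertonDyer.BirchSwinnertonDyer.Theorems.AlignedTransportAtTwoSharedCubicFieldDoor

end
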